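import Summits.Ventures.PercRepro.RLSRuleT0Planes
import Summits.Ventures.PercRepro.RLSRuleCoreLines

/-!
# C-025 at q = 3: the lane's gap is the planes with at least `6` points (night-3, gen 4)

On the core every plane with at most `5` points is a `𝒯₀` plane (no `4`-point line, at most two `3`-point lines:
`RLSRuleCoreLines`), settled at every type by `perFlat_T0_all`.  Hence

**`R3PlusPerFlat_of_big`**: the per-flat Prop of the lane at `(p, 3)`, `p ≥ 8`, follows from its restriction to the
planes with `≥ 6` points (`R3PlusPerFlatBig p`).  With `c025_three_of_R3Plus`: **C-025 at `q = 3` for every finite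
matroid and every `p ≥ 5` follows from the `(7, 3)` core and `R3PlusPerFlatBig p` for all `p ≥ 8`**
(`c025_three_of_big`).  What is left of the lane is exactly the large planes, where the hard-max half of `R₃⁺` acts
(a rank-`3` subset with `≥ 7` points beats every trace of another plane).
Imports `RLSRuleT0Planes`, `RLSRuleCoreLines`.  Axioms: standard.
-/

open scoped Matroid

namespace PercRepro

namespace NightThree

open Finset ThmH PerFlat

variable {α : Type*} [DecidableEq α] {M : Matroid α} [M.Finite]

/-! ### The reduction -/

/-- The per-flat Prop of the lane restricted to the planes with at least `6` points. -/
def R3PlusPerFlatBig (p : ℕ) : Prop :=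
  ∀ {β : Type} [DecidableEq β] (M : Matroid β) [M.Finite], Core M p →
    ∀ G ∈ flatsQ M 3, 6 ≤ G.card → phiK p 3 * ((UqG M p 3 G).card : ℚ) ≤ ∑ S ∈ Yq M p 3, wPlus M G S

/-- **The gap is the large planes.**  For `p ≥ 8`, `R3PlusPerFlat p` follows from its restriction to the planes
with `≥ 6` points: on the core a plane with `≤ 5` points is a `𝒯₀` plane (`perFlat_T0_all`). -/
theorem R3PlusPerFlat_of_big {p : ℕ} (hp : 8 ≤ p) (hbig : R3PlusPerFlatBig p) : R3PlusPerFlat p := by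
  intro β hβ M hM hc G hG
  rcases le_or_gt 6 G.card with h6 | h5
  · exact @hbig β hβ M hM hc G hG h6
  · obtain ⟨n, rfl⟩ : ∃ n, p = n + 4 := ⟨p - 4, by omega⟩
    have hGE : G ⊆ gr M := (mem_flatsQ.1 hG).1
    exact perFlat_T0_all hc hG (by omega)
      (card_depTriples_le_two_of_card_le_five (simpleOn_of_core hc hGE) (not_hasLongLine_of_core hc hGE) hGE
        (by omega)) (by omega)

/-- **C-025 at `q = 3` from the `(7, 3)` core and the large planes.**  If the `(7, 3)` core holds and `R₃⁺` satisfies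
the per-flat inequality on every plane with `≥ 6` points of every core matroid of every rank `p ≥ 8`, then `C025`
holds at `q = 3` for every finite matroid and every `p ≥ 5`. -/
theorem c025_three_of_big {β : Type}
    (hseven : ∀ (M : Matroid β) [M.Finite], Core M 7 → ThmN.RLS M 7 3)
    (hbig : ∀ p : ℕ, 8 ≤ p → R3PlusPerFlatBig p) :
    ∀ (M : Matroid β) [M.Finite] (p : ℕ), 5 ≤ p → ThmN.RLS M p 3 :=
  c025_three_of_R3Plus hseven (fun p hp => R3PlusPerFlat_of_big hp (hbig p hp))

end NightThree

end PercRepro
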